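import Summits.ResolutionOfSingularities.ResolutionOfSingularities.Theorems.EquisingularLiftEquisingularLiftNatLargeCharStrongHypSelf
import Summits.ResolutionOfSingularities.ResolutionOfSingularities.Theorems.FrobeniusClosingPatchingRelPerfectDepthSingleFormBasics
import Summits.ResolutionOfSingularities.ResolutionOfSingularities.Theorems.EquisingularLiftEquisingularLiftNatSaturatedLift
import Summits.ResolutionOfSingularities.ResolutionOfSingularities.Theorems.EquisingularLiftEquisingularLiftNatCompleteIntersectionLiftKey
import Summits.ResolutionOfSingularities.ResolutionOfSingularities.Theorems.EquisingularLiftEquisingularLiftProjectiveAmbientSmoothProper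
import Literature.AlgebraicGeometry.Resolution.ArithmeticalThreefoldsBlowupFormDimThree
import Literature.AlgebraicGeometry.Resolution.ProjectiveSpaceRegular
import Literature.AlgebraicGeometry.Morphisms.SubschemeIntegral
import Literature.AlgebraicGeometry.Motives.SmoothHypersurfaceIrreducible
import HarnessLib

/-!
# EL♮(3) / EL♮(n), RUNG LC «large characteristic» — (i) THE K-SIDE INPUTS PER IRREDUCIBLE FACTOR: the hypersurface `V₊(G)` of a PRIME form
# `G` on `ℙⁿ_K` (`n ≥ 1`) is an effective Cartier divisor with INTEGRAL subscheme, hence carries the characteristic-zero word of ✓ (B2-K)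

leafhand-res-equisingularlift-4 g0 (prover, 2026-08-31; one-generation line-first hand on stmt-ResolutionOfSingularities-20148 / -20038 / -15660, cell
`pub/decomp-res`).  Crux `EquisingularLiftNatThree` (`stmt-…-20148`; the rung is uniform in `n`, so also `stmt-…-20038`), line W4.5(b), RUNG LC (idea-2 g32
`Cruxes/EquisingularLiftNatThree/LARGE-CHAR-RUNG-idea2.md` v1.6; lh3's HONEST RESIDUAL (i) of `hspread`: «K-side inputs per irreducible factor `Pⱼ` of `F_K`»).
The door ✓ `exists_forall_descDoorAt_of_K_word_smooth` (…NatLargeCharSpreadDoorSmoothBase) eats, for an ideal sheaf `𝓣` on `ℙⁿ_A`, a K-side word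
`DescTransformOK t_K (𝟙 _) (supp 𝓣_K) (supp 𝓣_K)` with `K`-smooth centres and `V(𝓣_K)` INTEGRAL; ✓ `LargeChar.exists_centreSeq_descTransformOK_self`
(…NatLargeCharStrongHypSelf) produces such a word for an EFFECTIVE CARTIER ideal with reduced zero scheme.  For the universal degree-`d` hypersurface the
generic equation `F_K` need not be irreducible, so the composition runs factor by factor; this file supplies the two K-side facts about ONE prime factor,
DEF-FREE, by assembling tree lemmas:

* `isEffectiveCartier_projIdealSheaf_form` — for a field `K` and a non-zero form `G` of degree `e` on `ℙⁿ_K`, the form ideal sheaf `(G)~` is an effective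
  Cartier divisor (✓ `DepthTargets.projIdealSheaf_single_ne_bot_and_isLocallyPrincipal` + ✓ `IsLocallyPrincipal.isEffectiveCartier_of_ne_bot` on the integral
  `ℙⁿ_K`, ✓ `isIntegral_projectiveSpace`);
* `isIntegral_subscheme_projIdealSheaf_form` — for `n ≥ 1` and `G` PRIME, `V₊(G)` (the subscheme of `(G)~`) is INTEGRAL (✓ `Morphisms.isIntegral_subscheme`:
  radical by ✓ `SatLift.radical_projIdealSheaf_eq`, irreducible support `V₊(G) = closure {(G)}` by ✓ `SmoothHypersurface.isIrreducible_zeroLocus_of_prime`);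
* ★ `exists_K_word_form` — for `K` of characteristic `0`, `n ≥ 1`, `G` a prime form: a word `t_K : CentreSeq ℙⁿ_K` with `K`-smooth centres and
  `DescTransformOK t_K (𝟙 ℙⁿ_K) (supp (G)~) (supp (G)~)` (✓ (B2-K) stage-zero form, ✓ `isRegular_projectiveSpace`).

(`n = 0` is excluded: a prime form in one variable is `x₀` up to a unit and `V₊(x₀) = ∅` is not integral; the rung's composition treats `ℙ⁰` as the vacuous
case it is.)  EL♮(3) NOT proved; EL♮ NOT proved; resolution of singularities in positive characteristic NOT proved; nothing of [Hironaka2017] (a candidate under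
adjudication) is asserted or used.  [OURS · bookkeeping over tree lemmas · standard axioms · DEF-FREE · `--supports stmt-ResolutionOfSingularities-20148 --as helper`,
counted 0 · AI-written, weaker than expert review.] [cite: Hartshorne1977, II Prop. 5.9 and II Ex. 2.9] (method; index only)
-/

set_option linter.dupNamespace false -- mandated namespace `Summit.<Summit>.<Problem>` of this single-conjunct summit

noncomputable section

open CategoryTheory CategoryTheory.Limits AlgebraicGeometry TopologicalSpace Topology
open MvPolynomial
open Literature.AlgebraicGeometry.Resolution
open AlgebraicGeometry.Scheme.IdealSheafData

namespace Summit.ResolutionOfSingularities.ResolutionOfSingularities.Cruxes.EquisingularLiftNat.Sections.LargeChar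

section KInputs

variable (K : Type) [Field K] (n : ℕ)

/-- **The form ideal sheaf `(G)~` of a non-zero form on `ℙⁿ_K` is an effective Cartier divisor** (non-zero and locally principal on the integral `ℙⁿ_K`).
[cite: Hartshorne1977, II Prop. 5.9] [OURS · L1 W4.5b · RUNG LC (i)] -/
theorem isEffectiveCartier_projIdealSheaf_form {e : ℕ} (G : MvPolynomial (Fin (n + 1)) K) (hG : G.IsHomogeneous e) (hG0 : G ≠ 0) :
    letI := MvPolynomial.gradedAlgebra (σ := Fin (n + 1)) (R := K)
    IsEffectiveCartier (projIdealSheaf (homogeneousSubmodule (Fin (n + 1)) K)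
      ⟨Ideal.span (Set.range fun _ : Fin 1 => G),
        isHomogeneous_span_of_forall_mem _ (fun _ : Fin 1 => G) (fun _ => e) (fun _ => hG)⟩) := by
  letI := MvPolynomial.gradedAlgebra (σ := Fin (n + 1)) (R := K)
  haveI : IsIntegral (Proj (homogeneousSubmodule (Fin (n + 1)) K)) := isIntegral_projectiveSpace n K
  obtain ⟨hne, hlp⟩ :=
    Summit.ResolutionOfSingularities.ResolutionOfSingularities.Theorems.DepthTargets.projIdealSheaf_single_ne_bot_and_isLocallyPrincipal
      K n e (fun _ : Fin 1 => G) (fun _ => hG) hG0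
  exact hlp.isEffectiveCartier_of_ne_bot hne

/-- The support of `(G)~` is the zero locus `V₊(G)`. [cite: Hartshorne1977, II Prop. 5.9] [OURS · bookkeeping] -/
theorem support_projIdealSheaf_form {e : ℕ} (G : MvPolynomial (Fin (n + 1)) K) (hG : G.IsHomogeneous e) :
    letI := MvPolynomial.gradedAlgebra (σ := Fin (n + 1)) (R := K)
    ((projIdealSheaf (homogeneousSubmodule (Fin (n + 1)) K)
      ⟨Ideal.span (Set.range fun _ : Fin 1 => G),
        isHomogeneous_span_of_forall_mem _ (fun _ : Fin 1 => G) (fun _ => e) (fun _ => hG)⟩).support :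
        Set (Proj (homogeneousSubmodule (Fin (n + 1)) K))) =
      {y | G ∈ y.asHomogeneousIdeal} := by
  letI := MvPolynomial.gradedAlgebra (σ := Fin (n + 1)) (R := K)
  rw [CILift.support_projIdealSheaf_span (fun _ : Fin 1 => G) (fun _ => e) (fun _ => hG)]
  ext y
  simp only [Set.mem_setOf_eq]
  exact ⟨fun h => h 0, fun h _ => h⟩

/-- **`V₊(G)` is integral for a prime form `G` on `ℙⁿ_K`, `n ≥ 1`**: the ideal sheaf `(G)~` is radical (`(G)` is prime) and its support is the closure
of the point `(G)` of `Proj K[x₀,…,xₙ]`. [cite: Hartshorne1977, II Ex. 2.9] [OURS · L1 W4.5b · RUNG LC (i)] -/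
theorem isIntegral_subscheme_projIdealSheaf_form (hn : 1 ≤ n) {e : ℕ} (G : MvPolynomial (Fin (n + 1)) K) (hG : G.IsHomogeneous e)
    (hprime : Prime G) :
    letI := MvPolynomial.gradedAlgebra (σ := Fin (n + 1)) (R := K)
    IsIntegral (projIdealSheaf (homogeneousSubmodule (Fin (n + 1)) K)
      ⟨Ideal.span (Set.range fun _ : Fin 1 => G),
        isHomogeneous_span_of_forall_mem _ (fun _ : Fin 1 => G) (fun _ => e) (fun _ => hG)⟩).subscheme := by
  obtain ⟨m, rfl⟩ : ∃ m, n = m + 1 := ⟨n - 1, by omega⟩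
  letI := MvPolynomial.gradedAlgebra (σ := Fin (m + 1 + 1)) (R := K)
  refine Literature.AlgebraicGeometry.Morphisms.isIntegral_subscheme _ ?_ ?_
  · refine SatLift.radical_projIdealSheaf_eq _ ?_
    change (Ideal.span (Set.range fun _ : Fin 1 => G)).IsRadical
    rw [Set.range_const]
    exact ((Ideal.span_singleton_prime hprime.ne_zero).mpr hprime).isRadical
  · rw [support_projIdealSheaf_form K (m + 1) G hG]
    have hzl : {y : Proj (homogeneousSubmodule (Fin (m + 1 + 1)) K) | G ∈ y.asHomogeneousIdeal} =
        ProjectiveSpectrum.zeroLocus (homogeneousSubmodule (Fin (m + 1 + 1)) K) {G} := by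
      ext y
      change G ∈ y.asHomogeneousIdeal ↔ ({G} : Set (MvPolynomial (Fin (m + 1 + 1)) K)) ⊆ (y.asHomogeneousIdeal : Set _)
      rw [Set.singleton_subset_iff]
      rfl
    rw [hzl]
    exact Literature.AlgebraicGeometry.Motives.SmoothHypersurface.isIrreducible_zeroLocus_of_prime (n := m) G hG hprime

/-- ★ **The K-side word of one prime factor.**  `K` of characteristic `0`, `n ≥ 1`, `G` a prime form of degree `e` on `ℙⁿ_K`: there is a multiple blow-up
`t_K : CentreSeq ℙⁿ_K` with `K`-SMOOTH centres and `DescTransformOK t_K (𝟙 ℙⁿ_K) V₊(G) V₊(G)` (centres inside the running strict transforms, END regular) — the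
stage-zero form of ✓ (B2-K) on the effective Cartier `(G)~` with integral (so reduced) zero scheme, in the regular integral `ℙⁿ_K`.
[cite: Kollar2007, Thm. 3.69 and 3.58–3.60] [OURS · L1 W4.5b · RUNG LC (i); characteristic ZERO only; EL♮(3) NOT proved] -/
theorem exists_K_word_form [CharZero K] (hn : 1 ≤ n) {e : ℕ} (G : MvPolynomial (Fin (n + 1)) K) (hG : G.IsHomogeneous e) (hprime : Prime G) :
    letI := MvPolynomial.gradedAlgebra (σ := Fin (n + 1)) (R := K)
    ∃ tK : CentreSeq (Proj (homogeneousSubmodule (Fin (n + 1)) K)),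
      DescCentresSmoothOver tK
          (Proj.toSpecZero (homogeneousSubmodule (Fin (n + 1)) K) ≫
            Spec.map (CommRingCat.ofHom (algebraMap K (homogeneousSubmodule (Fin (n + 1)) K 0)))) ∧
      DescTransformOK tK (𝟙 (Proj (homogeneousSubmodule (Fin (n + 1)) K)))
        ((projIdealSheaf (homogeneousSubmodule (Fin (n + 1)) K)
          ⟨Ideal.span (Set.range fun _ : Fin 1 => G),
            isHomogeneous_span_of_forall_mem _ (fun _ : Fin 1 => G) (fun _ => e) (fun _ => hG)⟩).support :
            Set (Proj (homogeneousSubmodule (Fin (n + 1)) K)))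
        ((projIdealSheaf (homogeneousSubmodule (Fin (n + 1)) K)
          ⟨Ideal.span (Set.range fun _ : Fin 1 => G),
            isHomogeneous_span_of_forall_mem _ (fun _ : Fin 1 => G) (fun _ => e) (fun _ => hG)⟩).support :
            Set (Proj (homogeneousSubmodule (Fin (n + 1)) K))) := by
  letI := MvPolynomial.gradedAlgebra (σ := Fin (n + 1)) (R := K)
  set qK : Proj (homogeneousSubmodule (Fin (n + 1)) K) ⟶ Spec (.of K) :=
    Proj.toSpecZero (homogeneousSubmodule (Fin (n + 1)) K) ≫
      Spec.map (CommRingCat.ofHom (algebraMap K (homogeneousSubmodule (Fin (n + 1)) K 0))) with hqK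
  obtain ⟨hsm, hpr⟩ :=
    Summit.ResolutionOfSingularities.ResolutionOfSingularities.Cruxes.EquisingularLift.StrataSplit.stub_projectiveAmbientSmoothProper K n
  haveI := hsm
  haveI := hpr
  haveI : LocallyOfFiniteType qK := inferInstance
  haveI : QuasiCompact qK := inferInstance
  haveI : IsIntegral (Proj (homogeneousSubmodule (Fin (n + 1)) K)) := isIntegral_projectiveSpace n K
  have hreg : Scheme.IsRegular (Proj (homogeneousSubmodule (Fin (n + 1)) K)) := isRegular_projectiveSpace n K
  haveI := isIntegral_subscheme_projIdealSheaf_form K n hn G hG hprime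
  obtain ⟨t, hsmooth, -, hT⟩ := exists_centreSeq_descTransformOK_self qK hreg
    (isEffectiveCartier_projIdealSheaf_form K n G hG hprime.ne_zero)
  exact ⟨t, hsmooth, hT⟩

end KInputs

end Summit.ResolutionOfSingularities.ResolutionOfSingularities.Cruxes.EquisingularLiftNat.Sections.LargeChar

end
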